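import Summits.HodgeConjecture.HodgeConjecture.Theorems.NikulinTwinTransportRealMultiplicationPointwise
import Summits.HodgeConjecture.HodgeConjecture.Theorems.NikulinTwinTransportRealMultiplicationAnchorOfAlgebraic
import Summits.HodgeConjecture.HodgeConjecture.Theorems.NikulinTwinTransportTwinTransportRMPicardTwoSelfAdjoint

/-!
# Route NikulinTwinTransport · `RealMultiplicationSqrtTwoAlgebraic` (stmt-HodgeConjecture-13679) —
# the tight crux: the deliverable ⟺ RM-anchors at every Picard rank

`realMultiplicationSqrtTwoAlgebraic_of_rmAnchors` (file `…RealMultiplicationPointwise`) derives the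
route decl from RM-ANCHORS — the conclusion of the milestone crux `TwinTransportRMPicardTwo`
(stmt-HodgeConjecture-15067) for every Picard rank, i.e. its body verbatim without the clause
`finrank NS = 2` — plus Buskin's theorem (`HodgeIsometryAlgebraic`), the composition of algebraic
correspondences between surfaces and the three named facts. Conversely
`rmAnchors_of_realMultiplicationSqrtTwoAlgebraic` (file `…RealMultiplicationAnchorOfAlgebraic`)
produces RM-anchors from the deliverable, for cup-self-adjoint `e`; and self-adjointness is
automatic granted Lefschetz `(1,1)` (`realMultiplication_selfAdjoint`, file
`…TwinTransportRMPicardTwoSelfAdjoint`, Zarhin's theorem on the real carriers). Together: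

* `realMultiplicationSqrtTwoAlgebraic_iff_rmAnchors` — granted `HodgeIsometryAlgebraic`, the
  composition of correspondences, `LefschetzOneOneK3` and the three named facts, the route decl
  `RealMultiplicationSqrtTwoAlgebraic` is EQUIVALENT to "RM-anchors at every RM-`√2` surface"
  (the milestone crux with its Picard-rank clause deleted, `IsK3Surface` folded).

So the deliverable of route NikulinTwinTransport IS the transport crux restricted to the RM-`√2`
surfaces (all Picard ranks `2, 4, 6, 8`), modulo published theorems (Buskin, Lefschetz `(1,1)`,
markings / Hodge types of K3, Grothendieck's coniveau inclusion) and one formal debt (composition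
of correspondences = moving lemma). Prover seat prover-pitem-stmt-HodgeConjecture-13679-1.

## References

* [VanGeemenSchuett2023] B. van Geemen, M. Schütt, arXiv:2310.05196, Thm. 3.10, Rem. 4.9.
* [Varesco2023] M. Varesco, Math. Z. 305 (2023), §2, Thm. 2.1.
* [Buskin2019] N. Buskin, J. reine angew. Math. 755 (2019), Thm. 1.1.
* [Zarhin1983] Yu. G. Zarhin, J. reine angew. Math. 341 (1983), Thm. 1.5.1.
-/

noncomputable section

namespace Summit.HodgeConjecture.HodgeConjecture.Theorems.NikulinTwinTransport

open scoped Manifold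
open CategoryTheory MonoidalCategory SemiCartesianMonoidalCategory
open Literature.AlgebraicGeometry.Motives Literature.AlgebraicGeometry.HodgeTheory
open Literature.AlgebraicGeometry.Surfaces Literature.Geometry.Kaehler
open Literature.AlgebraicTopology.SingularHomology

/-- **The tight crux of the deliverable: `RealMultiplicationSqrtTwoAlgebraic` ⟺ RM-anchors at
every RM-`√2` K3 surface** (the body of crux `TwinTransportRMPicardTwo` without its Picard-rank
clause), granted Buskin's theorem (`HodgeIsometryAlgebraic`), the composition of algebraic
correspondences between surfaces, Lefschetz `(1,1)` (`LefschetzOneOneK3`) and the three named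
facts. (⟸) `realMultiplicationSqrtTwoAlgebraic_of_rmAnchors`; (⟹) the surface is its own partner
with `Ψ = e + ν̃` (`rmAnchor_at_of_realMultiplication_algebraic_at`), the self-adjointness of `e`
needed there being Zarhin's theorem (`realMultiplication_selfAdjoint`).
[cite: VanGeemenSchuett2023, Thm. 3.10 and Rem. 4.9] [cite: Buskin2019, Thm. 1.1]
[cite: Zarhin1983, Thm. 1.5.1] -/
theorem realMultiplicationSqrtTwoAlgebraic_iff_rmAnchors
    (hB : Theses.NikulinTwinTransport.HodgeIsometryAlgebraic)
    (hC : ∀ (μ : OrientationFamily), μ.HasPoincareDuality →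
      ∀ (A B C : SchemeOver ℂ) (hA : IsSmoothProjective 2 A) (hB : IsSmoothProjective 2 B)
        (hC : IsSmoothProjective 2 C),
        ∀ γ ∈ algebraicClasses (A ⊗ B) 2, ∀ γ₁ ∈ algebraicClasses (B ⊗ C) 2,
          ∃ γ₂ ∈ algebraicClasses (A ⊗ C) 2, ∀ x : complexBetti C (2 * 1),
            complexGysin μ (IsSmoothProjective.tensor_holds hA hC) hA (fst A C)
                (rfl : 2 * 1 + 2 * 2 + 2 * 2 = 2 * 1 + 2 * (2 + 2))
                (cupProduct (rfl : 2 * 1 + 2 * 2 = 2 * 1 + 2 * 2)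
                  (complexBetti.map (snd A C) (2 * 1) x) γ₂) =
              complexGysin μ (IsSmoothProjective.tensor_holds hA hB) hA (fst A B)
                (rfl : 2 * 1 + 2 * 2 + 2 * 2 = 2 * 1 + 2 * (2 + 2))
                (cupProduct (rfl : 2 * 1 + 2 * 2 = 2 * 1 + 2 * 2)
                  (complexBetti.map (snd A B) (2 * 1)
                    (complexGysin μ (IsSmoothProjective.tensor_holds hB hC) hB (fst B C)
                      (rfl : 2 * 1 + 2 * 2 + 2 * 2 = 2 * 1 + 2 * (2 + 2))
                      (cupProduct (rfl : 2 * 1 + 2 * 2 = 2 * 1 + 2 * 2)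
                        (complexBetti.map (snd B C) (2 * 1) x) γ₁)))
                  γ))
    (hL : Theses.NikulinTwinTransport.LefschetzOneOneK3)
    (hmark : Huybrechts_K3_marking_exists) (hHT : Huybrechts_K3_hodgeTypes_H2)
    (hG : Grothendieck1969_supportedClasses_le_hodgeConiveau) :
    Theses.NikulinTwinTransport.RealMultiplicationSqrtTwoAlgebraic ↔
      ∀ (μ : OrientationFamily), μ.HasPoincareDuality →
        ∀ (S : SchemeOver ℂ) (hS : IsK3Surface S) (p : complexBetti S (2 * 2)),
        (IsIntegralClass p ∧ ∀ q : complexBetti S (2 * 2), IsIntegralClass q → ∃ n : ℤ, q = n • p) →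
        ∀ (e : complexBetti S (2 * 1) →ₗ[ℂ] complexBetti S (2 * 1)),
          (∀ x, IsRationalClass x → IsRationalClass (e x)) →
          (∀ (i j : ℕ) x, IsOfHodgeType 2 S (2 * 1) i j x → IsOfHodgeType 2 S (2 * 1) i j (e x)) →
          (∀ d ∈ algebraicClasses S 1, e d = 0) →
          (∀ x : complexBetti S (2 * 1),
            (∀ d ∈ algebraicClasses S 1, cupProduct (rfl : 2 * 1 + 2 * 1 = 2 * 2) x d = 0) →
              e (e x) = (2 : ℂ) • x) →
        ∃ (S'' : SchemeOver ℂ) (hS'' : IsK3Surface S'') (p'' : complexBetti S'' (2 * 2)),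
          (IsIntegralClass p'' ∧
            ∀ q : complexBetti S'' (2 * 2), IsIntegralClass q → ∃ n : ℤ, q = n • p'') ∧
          ∃ Ψ : complexBetti S'' (2 * 1) ≃ₗ[ℂ] complexBetti S (2 * 1),
            (∀ y, IsRationalClass y → IsRationalClass (Ψ.symm y)) ∧
            (∀ (i j : ℕ) y, IsOfHodgeType 2 S (2 * 1) i j y →
              IsOfHodgeType 2 S'' (2 * 1) i j (Ψ.symm y)) ∧
            (∀ (u v : complexBetti S (2 * 1)) (b : ℂ),
              cupProduct (rfl : 2 * 1 + 2 * 1 = 2 * 2) u v = ((2 : ℂ) * b) • p →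
                cupProduct (rfl : 2 * 1 + 2 * 1 = 2 * 2) (Ψ.symm u) (Ψ.symm v) = b • p'') ∧
            ∃ γ ∈ algebraicClasses (S ⊗ S'') 2, ∀ x : complexBetti S'' (2 * 1),
              Ψ x = complexGysin μ (IsSmoothProjective.tensor_holds hS.1 hS''.1) hS.1 (fst S S'')
                (rfl : 2 * 1 + 2 * 2 + 2 * 2 = 2 * 1 + 2 * (2 + 2))
                (cupProduct (rfl : 2 * 1 + 2 * 2 = 2 * 1 + 2 * 2)
                  (complexBetti.map (snd S S'') (2 * 1) x) γ) :=
  ⟨fun h μ hμ _S hS p hp e he_rat he_type he_N he_T =>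
      rmAnchor_at_of_realMultiplication_algebraic_at hmark hHT hG μ hμ hS p hp e he_rat he_type
        (realMultiplication_selfAdjoint hmark hHT hG hL hS e he_rat he_type he_N he_T) he_N he_T
        (h μ hμ _ hS e he_rat he_type
          (realMultiplication_selfAdjoint hmark hHT hG hL hS e he_rat he_type he_N he_T) he_N he_T),
    fun hA => realMultiplicationSqrtTwoAlgebraic_of_rmAnchors hB hC hA hmark hHT hG⟩

end Summit.HodgeConjecture.HodgeConjecture.Theorems.NikulinTwinTransport

end
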